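import Literature.IUT.LogThetaLattice.HolomorphicHull
import Literature.IUT.LogVolume.HolomorphicHull
import Mathlib.Analysis.Normed.Module.Ball.Pointwise

/-!
# [IUTchIII] Remark 3.9.5 (i): the abstract holomorphic hull of `LogThetaLattice/HolomorphicHull.lean`
# agrees with the local-field hull of `LogVolume/HolomorphicHull.lean`; discharge of
# `holomorphicHull_isHullSet` (abc-iut-L6-lead ruling D6); PIN for Remark 3.9.5 (viii)

S. Mochizuki, *Inter-universal Teichmüller theory III*, kurims manuscript (May 2020), §3, Remark 3.9.5
(i), (ii), (viii), kurims pp. 127–128, 139–140. The typer's file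
(`Literature.IUT.LogThetaLattice.holomorphicHull`, abstract fields `k_i` with integral structures
`O_i`) recorded the printed well-definedness "One verifies immediately that the holomorphic hull is
well-defined [under the conditions stated]" as the NAMED statement `holomorphicHull_isHullSet`; the
campaign-S file (`Literature.IUT.LogVolume.holomorphicHull`, abc-iut-S2, p404153) PROVES existence and
minimality for finite direct sums of nonarchimedean local fields (`NontriviallyNormedField`,
`IsUltrametricDist`, `ProperSpace`; integral structure = closed unit ball). This bridge file shows that,
in that setting, the two notions of hull-set coincide (`isHullSet_iff`), the two hulls coincide on
bounded nondegenerate sets (`holomorphicHull_eq_logVolume`), and DISCHARGES the named statement: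
`holomorphicHull_isHullSet_holds` — for every finiteness predicate that implies nondegeneracy (the
printed "contains a relatively compact subset whose log-volume is finite" does: a set of positive
measure is nondegenerate). Also the PIN (SLOT-ONLY index entry) for Remark 3.9.5 (viii) requested by
abc-iut-L6-lead (INBOX 18:59:38Z). Tag form [claim: Mochizuki2012, status: disputed].
-/

namespace Literature.IUT.LogThetaLattice

open Set Metric Bornology
open scoped Pointwise

universe u v

section Bridge

variable {J : Type u} [Fintype J] (K : J → Type v) [∀ j, NontriviallyNormedField (K j)]
  [∀ j, IsUltrametricDist (K j)] [∀ j, ProperSpace (K j)]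
  (O : ∀ j, Subring (K j)) (hO : ∀ j, (O j : Set (K j)) = closedBall (0 : K j) 1)

omit [Fintype J] [∀ j, IsUltrametricDist (K j)] [∀ j, ProperSpace (K j)] in
/-- In a normed field, `λ · (closed unit ball) = closed ball of radius ‖λ‖` — the
identification of "`λ · 𝒪`" ([IUTchIII] Rmk. 3.9.5 (i), p. 127) with a polydisc component.
[claim: Mochizuki2012, status: disputed] -/
theorem image_mul_unitBall_eq {j : J} (c : K j) :
    (fun x => c * x) '' closedBall (0 : K j) 1 = closedBall (0 : K j) ‖c‖ := by
  have : (fun x : K j => c * x) = fun x => c • x := rfl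
  rw [this, Set.image_smul, smul_closedBall c (0 : K j) zero_le_one, smul_zero, mul_one]

include hO in
omit [Fintype J] [∀ j, IsUltrametricDist (K j)] [∀ j, ProperSpace (K j)] in
/-- The typer's hull-sets `Π_j λ_j · 𝒪_j` (`LogThetaLattice.IsHullSet`, integral structures = closed unit
balls) are EXACTLY the campaign-S hull-sets `λ · 𝒪_L = Π_j closedBall 0 ‖λ_j‖`
(`LogVolume.IsHullSet`) — [IUTchIII] Rmk. 3.9.5 (i), p. 127, one notion. PROVED.
[claim: Mochizuki2012, status: disputed] -/
theorem isHullSet_iff (H : Set (Π j, K j)) : IsHullSet O H ↔ LogVolume.IsHullSet K H := by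
  constructor
  · rintro ⟨lam, hlam, rfl⟩
    refine ⟨lam, hlam, ?_⟩
    unfold LogVolume.hullSet LogVolume.polydisc
    congr 1
    funext j
    rw [hO j, image_mul_unitBall_eq K (lam j)]
  · rintro ⟨c, hc, rfl⟩
    refine ⟨c, hc, ?_⟩
    unfold LogVolume.hullSet LogVolume.polydisc
    congr 1
    funext j
    rw [hO j, image_mul_unitBall_eq K (c j)]

include hO in
/-- On bounded (= relatively compact) NONDEGENERATE sets the two holomorphic hulls coincide: both are the
intersection of all hull-sets containing the set ([IUTchIII] Rmk. 3.9.5 (i)/(ii), p. 127: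
"`φ(P) = ⋂_{ℋ ∋ H ⊇ P} H`"). PROVED. [claim: Mochizuki2012, status: disputed] -/
theorem holomorphicHull_eq_logVolume {U : Set (Π j, K j)} (hU : IsBounded U)
    (hnd : LogVolume.IsNondegenerate K U) :
    holomorphicHull O U = LogVolume.holomorphicHull K U := by
  have hUc : IsCompact (closure U) := (LogVolume.isBounded_iff_isCompact_closure K U).mp hU
  unfold holomorphicHull
  rw [if_pos hUc, LogVolume.holomorphicHull_eq_sInter K hU hnd]
  congr 1
  ext H
  simp only [mem_setOf_eq, isHullSet_iff K O hO]

include hO in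
/-- **DISCHARGE of `holomorphicHull_isHullSet`** (abc-iut-L6-lead ruling D6): in a finite direct sum of
nonarchimedean local fields with integral structures the closed unit balls, the typer's named
well-definedness statement of [IUTchIII] Rmk. 3.9.5 (i) ("the holomorphic hull is well-defined [under
the conditions stated]") HOLDS for every finiteness-of-log-volume predicate that implies nondegeneracy
— by the campaign-S existence theorem `LogVolume.isHullSet_holomorphicHull` (sup of norms attained).
[claim: Mochizuki2012, status: disputed] -/
theorem holomorphicHull_isHullSet_holds (FiniteLogVol : Set (Π j, K j) → Prop)
    (hfin : ∀ U, FiniteLogVol U → LogVolume.IsNondegenerate K U) (U : Set (Π j, K j)) :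
    holomorphicHull_isHullSet O FiniteLogVol U := by
  intro hUc hfv
  have hU : IsBounded U := (LogVolume.isBounded_iff_isCompact_closure K U).mpr hUc
  have hnd := hfin U hfv
  rw [holomorphicHull_eq_logVolume K O hO hU hnd, isHullSet_iff K O hO]
  exact LogVolume.isHullSet_holomorphicHull K hU hnd

omit [Fintype J] [∀ j, IsUltrametricDist (K j)] [∀ j, ProperSpace (K j)] in
/-- Nondegeneracy from positive measure — the printed finiteness condition of Rmk. 3.9.5 (i) ("contains a
relatively compact subset whose log-volume is finite [i.e., `> −∞`]") implies nondegeneracy: a set all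
of whose elements have `j`-th component `0` lies in the coordinate hyperplane `{x | x_j = 0}`, so any
predicate that fails on subsets of coordinate hyperplanes (as "positive Haar measure" does) implies
`LogVolume.IsNondegenerate`. PROVED in this abstract form. [claim: Mochizuki2012, status: disputed] -/
theorem isNondegenerate_of_not_subset_hyperplane (FiniteLogVol : Set (Π j, K j) → Prop)
    (hhyp : ∀ (U : Set (Π j, K j)) (j : J), U ⊆ {x | x j = 0} → ¬ FiniteLogVol U)
    {U : Set (Π j, K j)} (hU : FiniteLogVol U) : LogVolume.IsNondegenerate K U := by
  intro j
  by_contra h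
  refine hhyp U j (fun x hx => ?_) hU
  by_contra hx'
  exact h ⟨x, hx, hx'⟩

end Bridge

/-- INTERFACE, SLOT-ONLY INDEX ENTRY (field of TYPE `Prop`, instantiable by `True`, NOT counted as typed
mathematical content; G2 wording), PIN requested by abc-iut-L6-lead (INBOX 18:59:38Z) because the proof
of Cor. 3.12 cites Remark 3.9.5 by number: **IUTchIII:Rmk3.9.5(viii)** (kurims p.139 l.18 – p.141
l.14) "just as in the case of the operations of (sQ1) Kummer-detachment …, and (sQ2) Galois evaluation
…, the operations of (sQ3) passing from more general regions to positive tensor powers of determinants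
of hulls and then applying the abstract set-theoretic `⊼`-formalism of (v) …, (sQ4) adjusting the
vertical shifts … by applying the log-Kummer correspondence …, as well as of (sQ5) passing to
log-volumes …, via the formalism of realified semi-simplifications discussed in Remark 3.9.4, may be
regarded as intricate (sub)quotient — or … push forward — operations". The mathematical objects named
here are typed elsewhere: hulls/`⊼` (`HolomorphicHull.lean`), log-Kummer correspondence
(`VerticallyCoricLGP.lean`, `GlobalKummerNonInterference.lean`), realified semi-simplifications
(`RealifiedSemisimplification.lean`). [claim: Mochizuki2012, status: disputed] -/
structure Remark395viiiIndex where
  /-- **IUTchIII:Rmk3.9.5(viii)** (kurims p.139 l.18) the (sQ1)–(sQ5) "(sub)quotient operations" reading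
  (SLOT-ONLY). -/
  viii : Prop

end Literature.IUT.LogThetaLattice
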